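import Summits.Ventures.Crystal3D.Theorems.StickyWulffConstantGenericWallFloorSlotSum
import Summits.Ventures.Crystal3D.Theorems.StickyWulffConstantNoReconstructionGainSampleDeficit
import HarnessLib

/-!
# A unimodular chart for every slot of `Λ₀`

HONEST FRAMING. Part of the venture `Summits/Ventures/Crystal3D` (cell `crystal3d-full`), helper for the
crux `GenericWallFloor` (stmt-Ventures-19480) of `route-Ventures-StickyWulffConstant`, line `WallLedgerG`:
module M1 of the rigid-bicrystal rung of `stub_twoSlabAdhesion` (note RIGID-RUNG-ARCH on the item) sums the
per-class run counts (`card_filter_add_notMem_le_lineCount`) over the twelve slots; each application needs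
a chart `(Ea, Eb, W = w)` of `Λ₀` — unit vectors with `det(Ea, Eb, w)² = ½` and INTEGER coordinate functions
`(fa, fb, ft)` of the site parameters with `barlowPos k i j = fa•Ea + fb•Eb + ft•w`.  This file provides it
for all twelve slots (`exists_chart_of_mem_fccSlots`), inverting the six chart identities of
`…NoReconstructionGainSampleDeficit` and flipping signs for the opposite slots.

WHAT THIS IS NOT: no counting; rung F-C1 not moved.
-/

noncomputable section

namespace Summit.Ventures.Crystal3D.Theorems

open Summit.Ventures.Crystal3D Finset Matrix
open Literature.MathematicalPhysics.StatisticalMechanics (barlowPos fccStacking constHagg haggLabel_const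
  barlowPos_mem)

/-- One chart, packaged: unit `Ea, Eb`, `det(Ea, Eb, w)² = ½`, integer coordinates. -/
def HasSlotChart (w : EuclideanSpace ℝ (Fin 3)) : Prop :=
  ∃ Ea Eb : EuclideanSpace ℝ (Fin 3), ‖Ea‖ ≤ 1 ∧ ‖Eb‖ ≤ 1 ∧
    (Matrix.det ![WithLp.ofLp Ea, WithLp.ofLp Eb, WithLp.ofLp w]) ^ 2 = 1 / 2 ∧
    ∃ fa fb ft : ℤ → ℤ → ℤ → ℤ, ∀ k i j : ℤ, barlowPos 1 (Real.sqrt (2 / 3)) constHagg k i j =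
      (fa k i j : ℝ) • Ea + (fb k i j : ℝ) • Eb + (ft k i j : ℝ) • w

/-- A chart for `w` gives a chart for `−w` (flip the third coordinate). -/
theorem hasSlotChart_neg {w : EuclideanSpace ℝ (Fin 3)} (h : HasSlotChart w) : HasSlotChart (-w) := by
  obtain ⟨Ea, Eb, hEa, hEb, hdet, fa, fb, ft, hf⟩ := h
  refine ⟨Ea, Eb, hEa, hEb, ?_, fa, fb, fun k i j => -ft k i j, fun k i j => ?_⟩
  · have e : Matrix.det ![WithLp.ofLp Ea, WithLp.ofLp Eb, WithLp.ofLp (-w)] =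
        -Matrix.det ![WithLp.ofLp Ea, WithLp.ofLp Eb, WithLp.ofLp w] := by
      rw [Matrix.det_fin_three, Matrix.det_fin_three]
      simp
      ring
    rw [e, neg_sq, hdet]
  · rw [hf k i j]; push_cast; module

/-- **Every slot has a unimodular chart.** -/
theorem exists_chart_of_mem_fccSlots {w : EuclideanSpace ℝ (Fin 3)} (hw : w ∈ fccSlots) :
    HasSlotChart w := by
  classical
  -- the three basic bond vectors and their unit norms
  have hu : ‖barlowPos 1 (Real.sqrt (2 / 3)) constHagg 0 1 0‖ = 1 := norm_barlowPos_fcc_eq_one (by norm_num)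
  have hv : ‖barlowPos 1 (Real.sqrt (2 / 3)) constHagg 0 0 1‖ = 1 := norm_barlowPos_fcc_eq_one (by norm_num)
  have ht : ‖barlowPos 1 (Real.sqrt (2 / 3)) constHagg 1 0 0‖ = 1 := norm_barlowPos_fcc_eq_one (by norm_num)
  have hvt : ‖barlowPos 1 (Real.sqrt (2 / 3)) constHagg (-1) 0 1‖ = 1 := norm_barlowPos_fcc_eq_one (by norm_num)
  have hut : ‖barlowPos 1 (Real.sqrt (2 / 3)) constHagg (-1) 1 0‖ = 1 := norm_barlowPos_fcc_eq_one (by norm_num)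
  have huv : ‖barlowPos 1 (Real.sqrt (2 / 3)) constHagg 0 1 (-1)‖ = 1 := norm_barlowPos_fcc_eq_one (by norm_num)
  -- the six positive classes
  have c_u : HasSlotChart (barlowPos 1 (Real.sqrt (2 / 3)) constHagg 0 1 0) :=
    ⟨_, _, hv.le, hvt.le, det_sq_barlowPos_fcc (by norm_num), fun k i j => j + k, fun k i j => -k,
      fun k i j => i, fun k i j => by
        rw [barlowPos_fcc_linear 1 _ k i j, barlowPos_fcc_linear 1 _ (-1) 0 1]; push_cast; module⟩
  have c_v : HasSlotChart (barlowPos 1 (Real.sqrt (2 / 3)) constHagg 0 0 1) :=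
    ⟨_, _, hu.le, hvt.le, det_sq_barlowPos_fcc (by norm_num), fun k i j => i, fun k i j => -k,
      fun k i j => j + k, fun k i j => by
        rw [barlowPos_fcc_linear 1 _ k i j, barlowPos_fcc_linear 1 _ (-1) 0 1]; push_cast; module⟩
  have c_vt : HasSlotChart (barlowPos 1 (Real.sqrt (2 / 3)) constHagg (-1) 0 1) :=
    ⟨_, _, hu.le, hv.le, det_sq_barlowPos_fcc (by norm_num), fun k i j => i, fun k i j => j + k,
      fun k i j => -k, fun k i j => by
        rw [barlowPos_fcc_linear 1 _ k i j, barlowPos_fcc_linear 1 _ (-1) 0 1]; push_cast; module⟩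
  have c_t : HasSlotChart (barlowPos 1 (Real.sqrt (2 / 3)) constHagg 1 0 0) :=
    ⟨_, _, hut.le, huv.le, det_sq_barlowPos_fcc (by norm_num), fun k i j => i + j, fun k i j => -j,
      fun k i j => k + i + j, fun k i j => by
        rw [barlowPos_fcc_linear 1 _ k i j, barlowPos_fcc_linear 1 _ (-1) 1 0,
          barlowPos_fcc_linear 1 _ 0 1 (-1)]; push_cast; module⟩
  have c_ut : HasSlotChart (barlowPos 1 (Real.sqrt (2 / 3)) constHagg (-1) 1 0) :=
    ⟨_, _, ht.le, huv.le, det_sq_barlowPos_fcc (by norm_num), fun k i j => k + i + j, fun k i j => -j,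
      fun k i j => i + j, fun k i j => by
        rw [barlowPos_fcc_linear 1 _ k i j, barlowPos_fcc_linear 1 _ (-1) 1 0,
          barlowPos_fcc_linear 1 _ 0 1 (-1)]; push_cast; module⟩
  have c_uv : HasSlotChart (barlowPos 1 (Real.sqrt (2 / 3)) constHagg 0 1 (-1)) :=
    ⟨_, _, ht.le, hut.le, det_sq_barlowPos_fcc (by norm_num), fun k i j => k + i + j, fun k i j => i + j,
      fun k i j => -j, fun k i j => by
        rw [barlowPos_fcc_linear 1 _ k i j, barlowPos_fcc_linear 1 _ (-1) 1 0,
          barlowPos_fcc_linear 1 _ 0 1 (-1)]; push_cast; module⟩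
  -- negatives
  have hneg : ∀ k i j : ℤ, barlowPos 1 (Real.sqrt (2 / 3)) constHagg (-k) (-i) (-j) =
      -barlowPos 1 (Real.sqrt (2 / 3)) constHagg k i j := by
    intro k i j
    rw [barlowPos_fcc_linear 1 _ (-k) (-i) (-j), barlowPos_fcc_linear 1 _ k i j]; push_cast; module
  -- case analysis on the slot
  rw [fccSlots, mem_image] at hw
  obtain ⟨c, hc, rfl⟩ := hw
  simp only [fccSlotTriples, mem_insert, mem_singleton] at hc
  rcases hc with rfl | rfl | rfl | rfl | rfl | rfl | rfl | rfl | rfl | rfl | rfl | rfl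
  · exact c_u
  · exact c_v
  · exact c_t
  · exact c_uv
  · exact c_ut
  · exact c_vt
  · have e := hneg 0 1 0; simp only [neg_zero] at e; rw [e]; exact hasSlotChart_neg c_u
  · have e := hneg 0 0 1; simp only [neg_zero] at e; rw [e]; exact hasSlotChart_neg c_v
  · have e := hneg 1 0 0; simp only [neg_zero] at e; rw [e]; exact hasSlotChart_neg c_t
  · have e := hneg 0 1 (-1); simp only [neg_zero, neg_neg] at e; rw [e]; exact hasSlotChart_neg c_uv
  · have e := hneg (-1) 1 0; simp only [neg_zero, neg_neg] at e; rw [e]; exact hasSlotChart_neg c_ut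
  · have e := hneg (-1) 0 1; simp only [neg_zero, neg_neg] at e; rw [e]; exact hasSlotChart_neg c_vt

end Summit.Ventures.Crystal3D.Theorems

end
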